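import Summits.BirchSwinnertonDyer.BirchSwinnertonDyer.Theorems.TameQuarticManinParityOptimalTwistIsTwistOfOptimalOfRigidity
import Summits.BirchSwinnertonDyer.BirchSwinnertonDyer.Theorems.TameQuarticManinParityTwistLatticeSandwich
import Summits.BirchSwinnertonDyer.BirchSwinnertonDyer.Theorems.TameQuarticManinParityThreeKernelSandwichRigidity
import Summits.BirchSwinnertonDyer.BirchSwinnertonDyer.Theorems.TameQuarticManinParityVariableChangeOfRationalHomothety
import HarnessLib

/-!
# Route `TameQuarticManinParity`, LINE 25b/25c (bsd-idea-3 g8), support α `TprimeIrrOptimalTwistIsTwistOfOptimal`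
# (stmt-BirchSwinnertonDyer-22822) — PROVED OUTRIGHT, by name: «the optimal curve of the twisted class IS the twist
# of the optimal curve» on the irreducible (t′) pairs at `3`

Cell `pub/bsd-wall`, D-0145 line `route-BirchSwinnertonDyer-TeichmullerTwistDescent`, seat `bsd-line-ttd-p1` g10,
completing the planner-of-record's LINE 25c chain. BSD is NOT proved by this; Manin's conjecture is not proved by this.

## Statement (the route decl, paraphrased)

For `W/ℚ` globally minimal, non-CM, (t′) at `3` of Kodaira type III with `E[3]` irreducible and a lattice-exact,
minimal-degree (X₀-optimal) conductor-level datum `D`, and any globally minimal `A` carrying a lattice-exact,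
minimal-degree datum `D'` for the twisted newform `D.f ⊗ χ₋₃`: `∃ v : VariableChange ℚ, v • W.quadraticTwist (−3) = A`.

## Proof

All inputs of the glue GA25 (`tprimeIrrOptimalTwistIsTwistOfOptimalOfRigidity_proof`, planner's proof landed by this
seat) are now theorems of the tree: S25 (`tprimeTwistLatticeSandwich_proof`: `3Λ(f) ⊆ g·Λ(f ⊗ χ) ⊆ Λ(f)`), R25
(`threeKernelSandwichRigidity_proof`: a `ℚ`-isogeny of degree `3` out of a curve with irreducible `E[3]` is impossible,
so the sandwich is extremal), I25 (`variableChangeOfRationalHomothety_proof`: a rational homothety of Néron-type lattices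
is a change of variables). No carrier (J₀(N), η-isogeny) is used. Design: one composition; no definition, no named
fact, no `sorry`; axioms `propext`, `Classical.choice`, `Quot.sound`.
-/

set_option autoImplicit false
-- D-0017: single-problem summit, so `Summit.BirchSwinnertonDyer.BirchSwinnertonDyer.…` repeats a namespace BY DESIGN.
set_option linter.dupNamespace false

namespace Summit.BirchSwinnertonDyer.BirchSwinnertonDyer.Theorems.TameQuarticManinParity

open Summit.BirchSwinnertonDyer.BirchSwinnertonDyer.Theses.TameQuarticManinParity

/-- **α `TprimeIrrOptimalTwistIsTwistOfOptimal`** (stmt-BirchSwinnertonDyer-22822), OUTRIGHT: on an irreducible (t′)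
twist pair of optimal data, the partner `A` is a model of `W ⊗ χ₋₃` (GA25 ∘ (S25, R25, I25)).
[cite: Stevens1989, Lemmas (5.2), (5.4)] [cite: SilvermanAEC2009, Thm. VI.4.1(b)] -/
theorem tprimeIrrOptimalTwistIsTwistOfOptimal_proof : TprimeIrrOptimalTwistIsTwistOfOptimal :=
  tprimeIrrOptimalTwistIsTwistOfOptimalOfRigidity_proof tprimeTwistLatticeSandwich_proof
    threeKernelSandwichRigidity_proof variableChangeOfRationalHomothety_proof

end Summit.BirchSwinnertonDyer.BirchSwinnertonDyer.Theorems.TameQuarticManinParity
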